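import Mathlib
import HarnessLib
import Summits.Ventures.LatticeQCDFlow.Exactness.QuasiStaticDissipation
import Summits.Ventures.LatticeQCDFlow.Scaling.VarianceLaws

/-!
# Thermodynamic integration and fluctuation–response along the linear defect family

HONEST FRAMING: exact (Metropolis-corrected) sampling algorithms for lattice gauge theory;
figures of merit are autocorrelation/cost numbers at stated couplings and volumes; no
continuum-physics claim.

Venture `LatticeQCDFlow` (cell pub-lqcd), topic `Exactness`, FANOUT row 8 (s0-cpn-nemc, GEN-4).
OUR WORK (elementary calculus on finite Gibbs families, `[folklore]` level); nothing here is cited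
as a fact.  Continues `Exactness/QuasiStaticDissipation.lean` (rows 8 GEN-2/3), whose module
docstring leaves open exactly the calculus typed here: for the linear family `S_c = S₀ + c • D`
(`linAction`, `meanD`, `linFreeEnergy` of that file; `varLaw` of `Scaling/VarianceLaws.lean`)

* `hasDerivAt_partitionFn_linAction`, `hasDerivAt_sum_mul_exp_neg_linAction` — `Z'(c) = −N_D(c)`
  for the Boltzmann sums `N_g(c) = Σ_x g x e^{−S_c x}`;
* `hasDerivAt_gibbsMean_linAction` — **fluctuation–response**: `d⟨g⟩_c/dc = −Cov_c(g, D)`;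
* `hasDerivAt_linFreeEnergy` — **thermodynamic integration**: `F'(c) = ⟨∂S_c/∂c⟩_c = ⟨D⟩_c`,
  and `linFreeEnergy_sub_eq_integral`: `F(b) − F(a) = ∫_a^b ⟨D⟩_c dc` (the free-energy
  difference the Jarzynski estimator of the NE-MCMC protocol measures, as an equilibrium integral);
* `hasDerivAt_meanD` — `d⟨D⟩_c/dc = −Var_c(D)` (`varD`; so `F'' = −Var_c D ≤ 0`, the calculus
  form of `meanD_antitone`), and `meanD_sub_eq_integral`;
* `hasDerivAt_varD`, `kappa3D_eq` — `dVar_c(D)/dc = −κ₃,c(D)` with `κ₃ = ⟨(D − ⟨D⟩)³⟩`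
  (`kappa3D`): the CURVATURE of `c ↦ ⟨D⟩_c` is the skewness of the switch observable;
* `abs_kappa3D_le` — the a-priori bound `|κ₃,c(D)| ≤ 8B³` when `|D| ≤ B`.

These feed `Exactness/QuasiStaticSecondOrder.lean` (the trapezoid law of the quasi-static floor).
Dictionary (OURS, HOME/s0-cpn-nemc/RESULTS.md §7(c), not proved here): at (N, β, L, L_d) =
(21, 0.7, 114, 24) the measured `Var_c(D)` runs 854(31), 844, 930, 1311(40), 703, 438, 269, 196,
176(4) at `c` = 0, .05, .1, .25, .375, .5, .75, .9, 1 — it is NOT monotone (`κ₃` changes sign near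
`c ≈ 0.25`: `⟨D⟩_c` is concave below, convex above), its trapezoid integral 594(8) reproduces
`⟨D⟩_0 − ⟨D⟩_1 = 593` (`meanD_sub_eq_integral`), and the steepest secant gives
`sup_c |κ₃,c(D)| ≥ 4.9(4)·10³`.
-/

namespace Summit.Ventures.LatticeQCDFlow.Exactness

open Finset Set MeasureTheory intervalIntegral
open Summit.Ventures.LatticeQCDFlow.Theory2 (partitionFn_pos gibbsLaw_pos sum_gibbsLaw varLaw
  varLaw_nonneg)

variable {X : Type*} [Fintype X]

/-! ## Variance and third central moment of the switch observable along the path -/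

/-- `Var_c(D)`: the variance of the switch observable under the `c`-law (the tree's `varLaw`). -/
noncomputable def varD (S₀ D : X → ℝ) (c : ℝ) : ℝ := varLaw (gibbsLaw (linAction S₀ D c)) D

/-- `κ₃,c(D) = ⟨(D − ⟨D⟩_c)³⟩_c`: the third central moment (un-normalised skewness) of the switch
observable under the `c`-law. -/
noncomputable def kappa3D (S₀ D : X → ℝ) (c : ℝ) : ℝ :=
  gibbsMean (linAction S₀ D c) (fun x => (D x - meanD S₀ D c) ^ 3)

/-- `Var_c(D) ≥ 0`. -/
theorem varD_nonneg [Nonempty X] (S₀ D : X → ℝ) (c : ℝ) : 0 ≤ varD S₀ D c :=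
  varLaw_nonneg (fun x => (gibbsLaw_pos _ x).le) (sum_gibbsLaw _) D

/-- `Var_c(D) = ⟨D²⟩_c − ⟨D⟩_c · ⟨D⟩_c` in the `gibbsMean` vocabulary. -/
theorem varD_eq (S₀ D : X → ℝ) (c : ℝ) :
    varD S₀ D c
      = gibbsMean (linAction S₀ D c) (fun x => D x ^ 2) - meanD S₀ D c * meanD S₀ D c := by
  simp only [varD, varLaw, meanD, gibbsMean, pow_two]

/-! ## Derivatives along the linear family: `Z' = −N_D`, `F' = ⟨D⟩`, `⟨g⟩' = −Cov(g, D)` -/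

/-- Derivative of a weighted Boltzmann sum `N_g(c) = Σ_x g x · e^{−S_c x}` (`N_1 = Z(c)`):
`N_g' = −N_{g D}`. -/
theorem hasDerivAt_sum_mul_exp_neg_linAction (S₀ D g : X → ℝ) (c : ℝ) :
    HasDerivAt (fun c => ∑ x, g x * Real.exp (-(linAction S₀ D c x)))
      (-(∑ x, g x * D x * Real.exp (-(linAction S₀ D c x)))) c := by
  have h : ∀ x ∈ (univ : Finset X), HasDerivAt (fun c => g x * Real.exp (-(linAction S₀ D c x)))
      (-(g x * D x * Real.exp (-(linAction S₀ D c x)))) c := by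
    intro x _
    have h1 : HasDerivAt (fun c : ℝ => -(linAction S₀ D c x)) (-(D x)) c := by
      have := (((hasDerivAt_id c).mul_const (D x)).const_add (S₀ x)).neg
      simp only [id, one_mul] at this
      exact this
    exact (h1.exp.const_mul (g x)).congr_deriv (by ring)
  rw [← sum_neg_distrib]
  exact HasDerivAt.fun_sum h

/-- `⟨g⟩_c` as a ratio of weighted Boltzmann sums. -/
theorem gibbsMean_linAction_eq_div (S₀ D g : X → ℝ) (c : ℝ) :
    gibbsMean (linAction S₀ D c) g
      = (∑ x, g x * Real.exp (-(linAction S₀ D c x))) / partitionFn (linAction S₀ D c) := by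
  unfold gibbsMean gibbsLaw
  rw [sum_div]
  exact sum_congr rfl (fun x _ => by ring)

/-- `Z' = −N_D` for the linear family. -/
theorem hasDerivAt_partitionFn_linAction (S₀ D : X → ℝ) (c : ℝ) :
    HasDerivAt (fun c => partitionFn (linAction S₀ D c))
      (-(∑ x, D x * Real.exp (-(linAction S₀ D c x)))) c := by
  have := hasDerivAt_sum_mul_exp_neg_linAction S₀ D (fun _ => (1:ℝ)) c
  simp only [one_mul] at this
  exact this

/-- **Fluctuation–response.**  `d⟨g⟩_c/dc = −Cov_c(g, D) = −(⟨g D⟩_c − ⟨g⟩_c ⟨D⟩_c)`. -/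
theorem hasDerivAt_gibbsMean_linAction [Nonempty X] (S₀ D g : X → ℝ) (c : ℝ) :
    HasDerivAt (fun c => gibbsMean (linAction S₀ D c) g)
      (-(gibbsMean (linAction S₀ D c) (fun x => g x * D x)
          - gibbsMean (linAction S₀ D c) g * meanD S₀ D c)) c := by
  have hN := hasDerivAt_sum_mul_exp_neg_linAction S₀ D g c
  have hZ := hasDerivAt_partitionFn_linAction S₀ D c
  have hZne : partitionFn (linAction S₀ D c) ≠ 0 := (partitionFn_pos _).ne'
  have hfun : (fun c => gibbsMean (linAction S₀ D c) g)
      = fun c =>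
        (∑ x, g x * Real.exp (-(linAction S₀ D c x))) / partitionFn (linAction S₀ D c) := by
    funext c
    exact gibbsMean_linAction_eq_div S₀ D g c
  rw [hfun]
  refine (hN.div hZ hZne).congr_deriv ?_
  simp only [meanD, gibbsMean_linAction_eq_div]
  field_simp
  ring

/-- **Thermodynamic integration.**  `dF/dc = ⟨∂S_c/∂c⟩_c = ⟨D⟩_c`. -/
theorem hasDerivAt_linFreeEnergy [Nonempty X] (S₀ D : X → ℝ) (c : ℝ) :
    HasDerivAt (linFreeEnergy S₀ D) (meanD S₀ D c) c := by
  have hZ := hasDerivAt_partitionFn_linAction S₀ D c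
  have hZne : partitionFn (linAction S₀ D c) ≠ 0 := (partitionFn_pos _).ne'
  show HasDerivAt (fun c => -Real.log (partitionFn (linAction S₀ D c))) (meanD S₀ D c) c
  refine (hZ.log hZne).neg.congr_deriv ?_
  rw [meanD, gibbsMean_linAction_eq_div]
  ring

/-- `d⟨D⟩_c/dc = −Var_c(D)` (so `F'' = −Var_c(D) ≤ 0`: `F` is concave, cf. `meanD_antitone`). -/
theorem hasDerivAt_meanD [Nonempty X] (S₀ D : X → ℝ) (c : ℝ) :
    HasDerivAt (meanD S₀ D) (-(varD S₀ D c)) c := by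
  refine (hasDerivAt_gibbsMean_linAction S₀ D D c).congr_deriv ?_
  simp only [varD_eq, meanD, gibbsMean, pow_two]

/-- Moment expansion of the third central moment: `κ₃ = ⟨D³⟩ − 3⟨D⟩⟨D²⟩ + 2⟨D⟩³`. -/
theorem kappa3D_eq [Nonempty X] (S₀ D : X → ℝ) (c : ℝ) :
    kappa3D S₀ D c = gibbsMean (linAction S₀ D c) (fun x => D x ^ 3)
      - 3 * meanD S₀ D c * gibbsMean (linAction S₀ D c) (fun x => D x ^ 2)
      + 2 * meanD S₀ D c ^ 3 := by
  unfold kappa3D gibbsMean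
  have h1 := sum_gibbsLaw (linAction S₀ D c)
  have hmean : ∑ x, gibbsLaw (linAction S₀ D c) x * D x = meanD S₀ D c := rfl
  have hx : ∀ x, gibbsLaw (linAction S₀ D c) x * (D x - meanD S₀ D c) ^ 3
      = gibbsLaw (linAction S₀ D c) x * D x ^ 3
        - 3 * meanD S₀ D c * (gibbsLaw (linAction S₀ D c) x * D x ^ 2)
        + 3 * meanD S₀ D c ^ 2 * (gibbsLaw (linAction S₀ D c) x * D x)
        - meanD S₀ D c ^ 3 * gibbsLaw (linAction S₀ D c) x := by
    intro x; ring
  simp_rw [hx]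
  simp only [sum_add_distrib, sum_sub_distrib, ← mul_sum, hmean, h1]
  ring

/-- `dVar_c(D)/dc = −κ₃,c(D)` (so `d²⟨D⟩_c/dc² = κ₃,c(D)`: the curvature of `c ↦ ⟨D⟩_c` is the
skewness of the switch observable). -/
theorem hasDerivAt_varD [Nonempty X] (S₀ D : X → ℝ) (c : ℝ) :
    HasDerivAt (varD S₀ D) (-(kappa3D S₀ D c)) c := by
  have h2 := hasDerivAt_gibbsMean_linAction S₀ D (fun x => D x ^ 2) c
  have h1 := (hasDerivAt_meanD S₀ D c).mul (hasDerivAt_meanD S₀ D c)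
  have hfun : varD S₀ D
      = fun c => gibbsMean (linAction S₀ D c) (fun x => D x ^ 2) - meanD S₀ D c * meanD S₀ D c :=
    funext (varD_eq S₀ D)
  rw [hfun]
  refine (h2.sub h1).congr_deriv ?_
  have e3 : gibbsMean (linAction S₀ D c) (fun x => D x ^ 2 * D x)
      = gibbsMean (linAction S₀ D c) (fun x => D x ^ 3) := by
    unfold gibbsMean
    exact sum_congr rfl (fun x _ => by ring)
  rw [e3, kappa3D_eq, varD_eq]
  ring

/-- `c ↦ ⟨D⟩_c` is continuous. -/
theorem continuous_meanD [Nonempty X] (S₀ D : X → ℝ) : Continuous (meanD S₀ D) :=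
  continuous_iff_continuousAt.mpr fun c => (hasDerivAt_meanD S₀ D c).continuousAt

/-- `c ↦ Var_c(D)` is continuous. -/
theorem continuous_varD [Nonempty X] (S₀ D : X → ℝ) : Continuous (varD S₀ D) :=
  continuous_iff_continuousAt.mpr fun c => (hasDerivAt_varD S₀ D c).continuousAt

/-- **TI formula.**  `F(b) − F(a) = ∫_a^b ⟨D⟩_c dc`. -/
theorem linFreeEnergy_sub_eq_integral [Nonempty X] (S₀ D : X → ℝ) (a b : ℝ) :
    linFreeEnergy S₀ D b - linFreeEnergy S₀ D a = ∫ c in a..b, meanD S₀ D c :=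
  (integral_eq_sub_of_hasDerivAt (fun c _ => hasDerivAt_linFreeEnergy S₀ D c)
    ((continuous_meanD S₀ D).intervalIntegrable a b)).symm

/-- `⟨D⟩_b − ⟨D⟩_a = −∫_a^b Var_c(D) dc`. -/
theorem meanD_sub_eq_integral [Nonempty X] (S₀ D : X → ℝ) (a b : ℝ) :
    meanD S₀ D b - meanD S₀ D a = -∫ c in a..b, varD S₀ D c := by
  rw [← intervalIntegral.integral_neg]
  exact (integral_eq_sub_of_hasDerivAt (fun c _ => hasDerivAt_meanD S₀ D c)
    ((continuous_varD S₀ D).neg.intervalIntegrable a b)).symm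

/-! ## An a-priori constant: bounded switch observable -/

/-- `|D| ≤ B` ⇒ `|κ₃,c(D)| ≤ 8 B³` for every `c`. -/
theorem abs_kappa3D_le [Nonempty X] (S₀ D : X → ℝ) {B : ℝ} (hB : ∀ x, |D x| ≤ B) (c : ℝ) :
    |kappa3D S₀ D c| ≤ 8 * B ^ 3 := by
  have hp := gibbsLaw_pos (linAction S₀ D c)
  have hp1 := sum_gibbsLaw (linAction S₀ D c)
  have hm : |meanD S₀ D c| ≤ B := by
    unfold meanD gibbsMean
    calc |∑ x, gibbsLaw (linAction S₀ D c) x * D x|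
        ≤ ∑ x, |gibbsLaw (linAction S₀ D c) x * D x| := abs_sum_le_sum_abs _ _
      _ ≤ ∑ x, gibbsLaw (linAction S₀ D c) x * B := sum_le_sum (fun x _ => by
          rw [abs_mul, abs_of_pos (hp x)]
          exact mul_le_mul_of_nonneg_left (hB x) (hp x).le)
      _ = B := by rw [← sum_mul, hp1, one_mul]
  have hdev : ∀ x, |D x - meanD S₀ D c| ≤ 2 * B := fun x => by
    have h1 := abs_le.mp (hB x)
    have h2 := abs_le.mp hm
    rw [abs_le]
    constructor <;> linarith
  unfold kappa3D gibbsMean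
  calc |∑ x, gibbsLaw (linAction S₀ D c) x * (D x - meanD S₀ D c) ^ 3|
      ≤ ∑ x, |gibbsLaw (linAction S₀ D c) x * (D x - meanD S₀ D c) ^ 3| :=
        abs_sum_le_sum_abs _ _
    _ ≤ ∑ x, gibbsLaw (linAction S₀ D c) x * (8 * B ^ 3) := sum_le_sum (fun x _ => by
        rw [abs_mul, abs_of_pos (hp x), abs_pow]
        refine mul_le_mul_of_nonneg_left ?_ (hp x).le
        calc |D x - meanD S₀ D c| ^ 3 ≤ (2 * B) ^ 3 := by gcongr; exact hdev x
          _ = 8 * B ^ 3 := by ring)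
    _ = 8 * B ^ 3 := by rw [← sum_mul, hp1, one_mul]

end Summit.Ventures.LatticeQCDFlow.Exactness
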